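import Mathlib
import Literature.MathematicalPhysics.StatisticalMechanics.Crystallization
import Literature.MathematicalPhysics.StatisticalMechanics.StickyChain

/-!
# Crux `ExactCertificate` (stmt-AtomisticToContinuum-11959), line `closure-makes-nogap-exact`,
# Transfer skeleton II (`Crystallization1D`): the stub `stub_lineSort`

Support file — nothing here closes an item.  The positional half of the d = 1 transfer of the crux
`ThreeConeCertificate.ExactCertificate` (skeleton II, `Crystallization1D`: crystallization of the
Lennard-Jones CHAIN) works throughout with ℕ-indexed sorted positions `y : ℕ → ℝ` on the line and
the LINE ENERGY `∑ i ∈ Finset.range N, ∑ j ∈ Finset.Ico (i + 1) N, V (|y j - y i|)`.  This file is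
the bridge from the tree's `interactionEnergy V x = ∑ i, ∑ j ∈ Finset.Ioi i, V (dist (x i) (x j))`
(`x : Fin N → ℝ¹`) to that form:

* (1) the interaction energy of the embedded configuration `i ↦ (y i) e₀` is the line energy of
  `y` (any `y : ℕ → ℝ`, sorted or not — `dist ((y i) e₀) ((y j) e₀) = |y j - y i|`);
* (2) every injective configuration of `ℝ¹` is, after a relabelling `σ = Tuple.sort (i ↦ x i 0)`,
  the embedding of a strictly increasing `y : ℕ → ℝ` (extended by `0` beyond index `N - 1`).

All `[folklore]`.
-/

noncomputable section

namespace Summit.AtomisticToContinuum.Crystallization.Theorems.ThreeConeCertificateExactCertificate.Transfer1D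

open Literature.MathematicalPhysics.StatisticalMechanics
open scoped BigOperators

/-- Re-indexing a pair sum: `∑_{i : Fin N} ∑_{j > i} g i j = ∑_{i < N} ∑_{i < j < N} g i j` with the
inner sum written over `Finset.Ico (i + 1) N`. [folklore] -/
theorem lineSort_sum_Ioi_eq_sum_range_Ico (N : ℕ) (g : ℕ → ℕ → ℝ) :
    ∑ i : Fin N, ∑ j ∈ Finset.Ioi i, g i j =
      ∑ i ∈ Finset.range N, ∑ j ∈ Finset.Ico (i + 1) N, g i j := by
  have inner : ∀ i : Fin N, ∑ j ∈ Finset.Ioi i, g i j = ∑ j ∈ Finset.Ico ((i : ℕ) + 1) N, g i j := by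
    intro i
    rw [Finset.Ico_add_one_left_eq_Ioo, ← Fin.map_valEmbedding_Ioi, Finset.sum_map]
    rfl
  simp_rw [inner]
  exact Fin.sum_univ_eq_sum_range (fun i => ∑ j ∈ Finset.Ico (i + 1) N, g i j) N

/-- The distance of two points `s e₀`, `t e₀` of the line `ℝ¹` is `|t - s|`. [folklore] -/
theorem lineSort_dist_single (s t : ℝ) :
    dist (EuclideanSpace.single (0 : Fin 1) s) (EuclideanSpace.single (0 : Fin 1) t) = |t - s| := by
  rw [EuclideanSpace.single, PiLp.dist_single_same, Real.dist_eq, abs_sub_comm]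

/-- A point of `ℝ¹` is its coordinate times `e₀`. [folklore] -/
theorem lineSort_eq_single (v : EuclideanSpace ℝ (Fin 1)) :
    v = EuclideanSpace.single (0 : Fin 1) (v 0) :=
  StickyChain.ext_zero (by rw [PiLp.single_eq_same])

/-- **Sorting and embedding.**  (1) The interaction energy of the embedded configuration
`i ↦ (y i)·e₀` of `ℝ¹` is the line energy of `y`; (2) every injective configuration of `ℝ¹` is,
after a relabelling `σ`, the embedding of a strictly increasing `y : ℕ → ℝ`. [folklore] -/
theorem stub_lineSort :
    (∀ (V : ℝ → ℝ) (N : ℕ) (y : ℕ → ℝ),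
      interactionEnergy V (fun i : Fin N => EuclideanSpace.single (0 : Fin 1) (y i)) =
        ∑ i ∈ Finset.range N, ∑ j ∈ Finset.Ico (i + 1) N, V (|y j - y i|)) ∧
    (∀ (N : ℕ) (x : Fin N → EuclideanSpace ℝ (Fin 1)), Function.Injective x →
      ∃ (σ : Equiv.Perm (Fin N)) (y : ℕ → ℝ), (∀ i j : ℕ, i < j → j < N → y i < y j) ∧
        ∀ i : Fin N, x (σ i) = EuclideanSpace.single (0 : Fin 1) (y i)) := by
  refine ⟨fun V N y => ?_, fun N x hx => ?_⟩
  · -- (1) the embedded energy is the line energy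
    rw [interactionEnergy, ← lineSort_sum_Ioi_eq_sum_range_Ico N (fun i j => V (|y j - y i|))]
    refine Finset.sum_congr rfl fun i _ => Finset.sum_congr rfl fun j _ => ?_
    rw [lineSort_dist_single]
  · -- (2) sort the coordinates
    set f : Fin N → ℝ := fun i => x i 0 with hf
    have hfinj : Function.Injective f := StickyChain.injective_coord hx
    set σ : Equiv.Perm (Fin N) := Tuple.sort f with hσ
    have hmono : StrictMono (f ∘ σ) :=
      (Tuple.monotone_sort f).strictMono_of_injective (hfinj.comp σ.injective)
    refine ⟨σ, fun i => if h : i < N then f (σ ⟨i, h⟩) else 0, fun i j hij hjN => ?_, fun i => ?_⟩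
    · have hiN : i < N := hij.trans hjN
      simp only [dif_pos hiN, dif_pos hjN]
      exact hmono (Fin.mk_lt_mk.2 hij)
    · simp only [dif_pos i.is_lt, Fin.eta]
      exact lineSort_eq_single (x (σ i))

end Summit.AtomisticToContinuum.Crystallization.Theorems.ThreeConeCertificateExactCertificate.Transfer1D

end
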